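import Mathlib
import Summits.Ventures.PercRepro2.Defs
import Summits.Ventures.PercRepro2.Independence
import Summits.Ventures.PercRepro2.Harris
import Summits.Ventures.PercRepro2.Graph
import Summits.Ventures.PercRepro2.Exploration
import Summits.Ventures.PercRepro2.Events
import Summits.Ventures.PercRepro2.Induced
import Summits.Ventures.PercRepro2.R2PrimeThreeReduction
import Summits.Ventures.PercRepro2.YBridge
import Summits.Ventures.PercRepro2.HCov
import Summits.Ventures.PercRepro2.HubModel
import Summits.Ventures.PercRepro2.HubModel3
import Summits.Ventures.PercRepro2.HubLaw3
import Summits.Ventures.PercRepro2.HubPat3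
import Summits.Ventures.PercRepro2.HubHarris3
import Summits.Ventures.PercRepro2.HubBundle3
import Summits.Ventures.PercRepro2.HubEvents3
import Summits.Ventures.PercRepro2.HubBern3
import Summits.Ventures.PercRepro2.HubGc3

/-!
# Kronecker substitution over the atoms: the a₃-hub table of a type vector as one big integer
(blind cell PercRepro2, mine-2 g17; typer-1's `HubKron` (S4) transposed: digits indexed by ATOM
triples instead of type vectors, one number per type vector `k`)

The a₃-hub table `Wtot3 k π₁ π₂ π₃` (HubGc3.lean) is needed only on the 15 atoms
`atomPat3 a` (HubHarris3.lean). A hub function `Φ` at a state `w` is encoded on the atoms as the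
integer `kronA Φ w j = Σ_a Φ w (atomPat3 a) · KB^{j·a}` (`KB = 2^32`, stride `j`); with the strides
`1, 15, 225` a product of three encodings is the encoding of the triple table on the index
`idxA (a, b, c) = a + 15 b + 225 c < 3375` (`kronA_mul_mul`), and summing over the state triples of
profile `k` gives the **Kronecker hub number** `kronK k = Σ_t Wtot3 k (atoms t) · KB^{idxA t}`
(`kronK_eq`; the eight products of `GcB3`). Its digits are `|Wtot3| ≤ 38 · 4096 < 2^31`
(`abs_Wtot3_le`), so `digits_unique_idxA` recovers the table from the number: the kernel checks
`kronK k = certK k` (one GMP computation per `k`, `HubTab3Check*.lean`) against the certified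
table `hub3_W.txt` (`HubTab3Data*.lean`), and the table identity follows digit by digit.
-/

namespace Summit.Ventures.PercRepro2.Hub3

open Hub

section Index

/-- The index of an atom triple: `a + 15 b + 225 c`. -/
def idxA (t : Fin 15 × Fin 15 × Fin 15) : ℕ := (t.1 : ℕ) + 15 * (t.2.1 : ℕ) + 225 * (t.2.2 : ℕ)

/-- The inverse of `idxA`. -/
def decodeA (n : ℕ) : Fin 15 × Fin 15 × Fin 15 :=
  (⟨n % 15, Nat.mod_lt _ (by norm_num)⟩, ⟨n / 15 % 15, Nat.mod_lt _ (by norm_num)⟩,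
    ⟨n / 225 % 15, Nat.mod_lt _ (by norm_num)⟩)

/-- `idxA < 3375`. -/
lemma idxA_lt (t : Fin 15 × Fin 15 × Fin 15) : idxA t < 3375 := by
  unfold idxA
  have := t.1.isLt
  have := t.2.1.isLt
  have := t.2.2.isLt
  omega

/-- `decodeA` inverts `idxA`. -/
lemma decodeA_idxA (t : Fin 15 × Fin 15 × Fin 15) : decodeA (idxA t) = t := by
  obtain ⟨⟨a, ha⟩, ⟨b, hb⟩, ⟨c, hc⟩⟩ := t
  unfold decodeA idxA
  simp only [Prod.mk.injEq, Fin.mk.injEq]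
  omega

/-- `idxA` inverts `decodeA` below `3375`. -/
lemma idxA_decodeA {n : ℕ} (hn : n < 3375) : idxA (decodeA n) = n := by
  unfold decodeA idxA
  simp only
  omega

end Index

section Kron

/-- The Kronecker base `2^32`. -/
def KB : ℤ := 2 ^ 32

/-- The Kronecker encoding of a hub function at a state on the atoms, with stride `j`. -/
def kronA (Φ : HubFn3) (w : Fin 4 → Bool) (j : ℕ) : ℤ :=
  ∑ a : Fin 15, Φ w (atomPat3 a) * KB ^ (j * (a : ℕ))

/-- **Kronecker substitution over the atoms**: the three strided encodings multiply to the
encoding of the triple table on `idxA`. -/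
theorem kronA_mul_mul (Φ₁ Φ₂ Φ₃ : HubFn3) (w₁ w₂ w₃ : Fin 4 → Bool) :
    kronA Φ₁ w₁ 1 * kronA Φ₂ w₂ 15 * kronA Φ₃ w₃ 225 =
      ∑ t : Fin 15 × Fin 15 × Fin 15,
        Φ₁ w₁ (atomPat3 t.1) * Φ₂ w₂ (atomPat3 t.2.1) * Φ₃ w₃ (atomPat3 t.2.2) * KB ^ idxA t := by
  unfold kronA
  rw [sum_mul_sum_mul_sum]
  simp only [Fintype.sum_prod_type]
  refine Finset.sum_congr rfl fun a _ => Finset.sum_congr rfl fun b _ =>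
    Finset.sum_congr rfl fun c _ => ?_
  unfold idxA
  rw [pow_add, pow_add]
  ring

/-- The Kronecker number of a triple of hub functions at the type vector `k`. -/
def kronZ (Φ₁ Φ₂ Φ₃ : HubFn3) (k : Fin 4 → Fin 4) : ℤ :=
  ∑ t : (Fin 4 → Bool) × (Fin 4 → Bool) × (Fin 4 → Bool) with prof t.1 t.2.1 t.2.2 = k,
    kronA Φ₁ t.1 1 * kronA Φ₂ t.2.1 15 * kronA Φ₃ t.2.2 225

/-- **The Kronecker number of a triple carries its hub table.** -/
theorem kronZ_eq (Φ₁ Φ₂ Φ₃ : HubFn3) (k : Fin 4 → Fin 4) :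
    kronZ Φ₁ Φ₂ Φ₃ k = ∑ t : Fin 15 × Fin 15 × Fin 15,
      wZ3 Φ₁ Φ₂ Φ₃ k (atomPat3 t.1) (atomPat3 t.2.1) (atomPat3 t.2.2) * KB ^ idxA t := by
  unfold kronZ wZ3
  simp only [kronA_mul_mul, Finset.sum_mul]
  rw [Finset.sum_comm]

/-- **The Kronecker hub number** of a type vector: the eight products of `GcB3`. -/
def kronK (k : Fin 4 → Fin 4) : ℤ :=
  kronZ fQ3 fPD3 fEQbo3 k + kronZ fQ3 fDo3 fEQb33 k - kronZ fQ3 fPD3 fEQb3o3 k +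
    kronZ fgap3 fPD3 fEQo3 k + kronZ fgap3 fDo3 fEQ33 k - kronZ fgap3 fPD3 fEQ3o3 k +
    kronZ fQ3 fDo3 fPDb3 k - kronZ fQ3 fPD3 fPDbo3 k

/-- **The Kronecker hub number carries the a₃-hub table on the atoms**:
`kronK k = Σ_t Wtot3 k (atoms t) · KB^{idxA t}`. -/
theorem kronK_eq (k : Fin 4 → Fin 4) :
    kronK k = ∑ t : Fin 15 × Fin 15 × Fin 15,
      Wtot3 k (atomPat3 t.1) (atomPat3 t.2.1) (atomPat3 t.2.2) * KB ^ idxA t := by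
  unfold kronK
  simp only [kronZ_eq, ← Finset.sum_add_distrib, ← Finset.sum_sub_distrib]
  refine Finset.sum_congr rfl fun t _ => ?_
  unfold Wtot3
  simp only [Pi.add_apply, Pi.sub_apply]
  ring

end Kron

section Digits

/-- **Digit uniqueness**: two digit vectors with digits in `[0, B)` and the same value agree. -/
theorem digits_unique (B : ℤ) (hB : 0 < B) : ∀ (N : ℕ) (a b : ℕ → ℤ),
    (∀ n < N, 0 ≤ a n ∧ a n < B) → (∀ n < N, 0 ≤ b n ∧ b n < B) →
    ∑ n ∈ Finset.range N, a n * B ^ n = ∑ n ∈ Finset.range N, b n * B ^ n → ∀ n < N, a n = b n := by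
  intro N
  induction N with
  | zero => intro a b _ _ _ n hn; exact absurd hn (Nat.not_lt_zero n)
  | succ N ih =>
    intro a b ha hb h n hn
    have e : ∀ c : ℕ → ℤ, ∑ n ∈ Finset.range (N + 1), c n * B ^ n =
        c 0 + B * ∑ n ∈ Finset.range N, c (n + 1) * B ^ n := by
      intro c
      rw [Finset.sum_range_succ', Finset.mul_sum]
      simp only [pow_zero, mul_one, pow_succ]
      rw [add_comm]
      congr 1
      exact Finset.sum_congr rfl fun n _ => by ring
    rw [e a, e b] at h
    have ha0 := ha 0 (Nat.succ_pos N)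
    have hb0 := hb 0 (Nat.succ_pos N)
    have hmod : ∀ (c : ℤ) (X : ℤ), 0 ≤ c → c < B → (c + B * X) % B = c := by
      intro c X hc hcB
      rw [Int.add_mul_emod_self_left, Int.emod_eq_of_lt hc hcB]
    have h0 : a 0 = b 0 := by
      have := congrArg (· % B) h
      rwa [hmod _ _ ha0.1 ha0.2, hmod _ _ hb0.1 hb0.2] at this
    have htail : ∑ n ∈ Finset.range N, a (n + 1) * B ^ n =
        ∑ n ∈ Finset.range N, b (n + 1) * B ^ n := by
      rw [h0] at h
      have := add_left_cancel h
      exact mul_left_cancel₀ hB.ne' this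
    rcases n with _ | n
    · exact h0
    · exact ih (fun n => a (n + 1)) (fun n => b (n + 1)) (fun n hn => ha (n + 1) (by omega))
        (fun n hn => hb (n + 1) (by omega)) htail n (by omega)

/-- **Balanced digit uniqueness**: digit vectors with entries of absolute value `< H` and the
same value in base `2H` agree. -/
theorem digits_unique_balanced (H : ℤ) (hH : 0 < H) (N : ℕ) (a b : ℕ → ℤ)
    (ha : ∀ n < N, |a n| < H) (hb : ∀ n < N, |b n| < H)
    (h : ∑ n ∈ Finset.range N, a n * (2 * H) ^ n = ∑ n ∈ Finset.range N, b n * (2 * H) ^ n) :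
    ∀ n < N, a n = b n := by
  have key := digits_unique (2 * H) (by positivity) N (fun n => a n + H) (fun n => b n + H)
    (fun n hn => by have := abs_lt.1 (ha n hn); constructor <;> linarith)
    (fun n hn => by have := abs_lt.1 (hb n hn); constructor <;> linarith)
    (by simp only [add_mul, Finset.sum_add_distrib, h])
  intro n hn
  have := key n hn
  simpa using this

/-- **Digit uniqueness over atom triples**: functions on the atom triples with values of absolute
value `< 2^31` and equal Kronecker numbers are equal. -/
theorem digits_unique_idxA (a b : Fin 15 × Fin 15 × Fin 15 → ℤ) (ha : ∀ t, |a t| < 2 ^ 31)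
    (hb : ∀ t, |b t| < 2 ^ 31)
    (h : ∑ t, a t * KB ^ idxA t = ∑ t, b t * KB ^ idxA t) : a = b := by
  classical
  let a' : ℕ → ℤ := fun n => if n < 3375 then a (decodeA n) else 0
  let b' : ℕ → ℤ := fun n => if n < 3375 then b (decodeA n) else 0
  have tr : ∀ c : Fin 15 × Fin 15 × Fin 15 → ℤ,
      ∑ t, c t * KB ^ idxA t =
        ∑ n ∈ Finset.range 3375, (if n < 3375 then c (decodeA n) else 0) * KB ^ n := by
    intro c
    refine Finset.sum_nbij' idxA decodeA (fun t _ => ?_) (fun n hn => Finset.mem_univ _)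
      (fun t _ => decodeA_idxA t) (fun n hn => ?_) (fun t _ => ?_)
    · exact Finset.mem_range.2 (idxA_lt t)
    · exact idxA_decodeA (Finset.mem_range.1 hn)
    · rw [if_pos (idxA_lt t), decodeA_idxA]
  have hKB : KB = 2 * 2 ^ 31 := by norm_num [KB]
  rw [tr a, tr b, hKB] at h
  have key := digits_unique_balanced (2 ^ 31) (by positivity) 3375 a' b'
    (fun n hn => by simp only [a', if_pos hn]; exact ha _)
    (fun n hn => by simp only [b', if_pos hn]; exact hb _) h
  funext t
  have := key (idxA t) (idxA_lt t)
  simp only [a', b', if_pos (idxA_lt t), decodeA_idxA] at this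
  exact this

end Digits

section Bounds

/-- An indicator lies in `[0, 1]`. -/
lemma ind3_mem (Ψ : HubEvt3) (w : Fin 4 → Bool) (π : Fin 6 → Bool) :
    0 ≤ ind3 Ψ w π ∧ ind3 Ψ w π ≤ 1 := by
  unfold ind3
  split_ifs <;> norm_num

/-- Bounds of the twelve hub functions (crude: the number of indicators). -/
lemma abs_hub3_le (w : Fin 4 → Bool) (π : Fin 6 → Bool) :
    |fQ3 w π| ≤ 1 ∧ |fPD3 w π| ≤ 1 ∧ |fDo3 w π| ≤ 2 ∧ |fgap3 w π| ≤ 1 ∧ |fEQbo3 w π| ≤ 4 ∧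
      |fEQb33 w π| ≤ 4 ∧ |fEQb3o3 w π| ≤ 8 ∧ |fEQo3 w π| ≤ 2 ∧ |fEQ33 w π| ≤ 2 ∧
      |fEQ3o3 w π| ≤ 4 ∧ |fPDb3 w π| ≤ 2 ∧ |fPDbo3 w π| ≤ 4 := by
  have h := fun Ψ => ind3_mem Ψ w π
  unfold fQ3 fPD3 fDo3 fgap3 fEQbo3 fEQb33 fEQb3o3 fEQo3 fEQ33 fEQ3o3 fPDb3 fPDbo3
  simp only [Pi.add_apply, Pi.sub_apply]
  refine ⟨?_, ?_, ?_, ?_, ?_, ?_, ?_, ?_, ?_, ?_, ?_, ?_⟩ <;>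
    (rw [abs_le]; constructor <;> linarith [h hQ3, h hPD3, h (hand3 hPD3 o13), h (hand3 hPD3 o23),
      h b23, h b13, h (hand3 hQ3 (hand3 o13 b13)), h (hand3 hQ3 (hand3 o23 b23)),
      h (hand3 hQ3 (hand3 o23 b13)), h (hand3 hQ3 (hand3 o13 b23)), h (hand3 hT'3 b13),
      h (hand3 hT3 b23), h (hand3 hT3 b13), h (hand3 hT'3 b23), h (hand3 hT'3 (hand3 o13 b13)),
      h (hand3 hT'3 (hand3 o23 b13)), h (hand3 hT3 (hand3 o13 b23)), h (hand3 hT3 (hand3 o23 b23)),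
      h (hand3 hT3 (hand3 o13 b13)), h (hand3 hT3 (hand3 o23 b13)), h (hand3 hT'3 (hand3 o13 b23)),
      h (hand3 hT'3 (hand3 o23 b23)), h (hand3 hQ3 o13), h (hand3 hQ3 o23), h hT'3, h hT3,
      h (hand3 hT'3 o13), h (hand3 hT'3 o23), h (hand3 hT3 o13), h (hand3 hT3 o23),
      h (hand3 hPD3 b13), h (hand3 hPD3 b23), h (hand3 hPD3 (hand3 o13 b13)),
      h (hand3 hPD3 (hand3 o23 b13)), h (hand3 hPD3 (hand3 o13 b23)),
      h (hand3 hPD3 (hand3 o23 b23))])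

/-- The number of state triples is `2^12`. -/
lemma card_triples3 :
    Fintype.card ((Fin 4 → Bool) × (Fin 4 → Bool) × (Fin 4 → Bool)) = 4096 := by
  simp [Fintype.card_prod, Fintype.card_bool, Fintype.card_fin]

/-- A hub table of three bounded hub functions is bounded by the product of the bounds times the
number of state triples. -/
lemma abs_wZ3_le {Φ₁ Φ₂ Φ₃ : HubFn3} {c₁ c₂ c₃ : ℤ} (h₁ : ∀ w π, |Φ₁ w π| ≤ c₁)
    (h₂ : ∀ w π, |Φ₂ w π| ≤ c₂) (h₃ : ∀ w π, |Φ₃ w π| ≤ c₃) (k : Fin 4 → Fin 4)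
    (π₁ π₂ π₃ : Fin 6 → Bool) : |wZ3 Φ₁ Φ₂ Φ₃ k π₁ π₂ π₃| ≤ c₁ * c₂ * c₃ * 4096 := by
  have hc₁ : 0 ≤ c₁ := (abs_nonneg _).trans (h₁ (fun _ => false) π₁)
  have hc₂ : 0 ≤ c₂ := (abs_nonneg _).trans (h₂ (fun _ => false) π₂)
  unfold wZ3
  refine (Finset.abs_sum_le_sum_abs _ _).trans ?_
  have hterm : ∀ t ∈ (Finset.univ : Finset ((Fin 4 → Bool) × (Fin 4 → Bool) × (Fin 4 → Bool))).filter
      (fun t => prof t.1 t.2.1 t.2.2 = k),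
      |Φ₁ t.1 π₁ * Φ₂ t.2.1 π₂ * Φ₃ t.2.2 π₃| ≤ c₁ * c₂ * c₃ := by
    intro t _
    rw [abs_mul, abs_mul]
    exact mul_le_mul (mul_le_mul (h₁ _ _) (h₂ _ _) (abs_nonneg _) hc₁) (h₃ _ _) (abs_nonneg _)
      (mul_nonneg hc₁ hc₂)
  refine (Finset.sum_le_card_nsmul _ _ _ hterm).trans ?_
  rw [nsmul_eq_mul]
  have hcard : ((Finset.univ.filter fun t : (Fin 4 → Bool) × (Fin 4 → Bool) × (Fin 4 → Bool) =>
      prof t.1 t.2.1 t.2.2 = k).card : ℤ) ≤ 4096 := by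
    have := Finset.card_filter_le (Finset.univ : Finset ((Fin 4 → Bool) × (Fin 4 → Bool) × (Fin 4 → Bool)))
      (fun t => prof t.1 t.2.1 t.2.2 = k)
    rw [Finset.card_univ, card_triples3] at this
    exact_mod_cast this
  have hc : 0 ≤ c₁ * c₂ * c₃ := mul_nonneg (mul_nonneg hc₁ hc₂)
    ((abs_nonneg _).trans (h₃ (fun _ => false) π₃))
  calc _ ≤ (4096 : ℤ) * (c₁ * c₂ * c₃) := mul_le_mul_of_nonneg_right hcard hc
    _ = _ := by ring

/-- **The a₃-hub table is bounded**: `|W_k| ≤ 38 · 4096 < 2^31`. -/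
theorem abs_Wtot3_le (k : Fin 4 → Fin 4) (π₁ π₂ π₃ : Fin 6 → Bool) :
    |Wtot3 k π₁ π₂ π₃| ≤ 38 * 4096 := by
  have hb := fun w π => abs_hub3_le w π
  have e1 := abs_wZ3_le (fun w π => (hb w π).1) (fun w π => (hb w π).2.1)
    (fun w π => (hb w π).2.2.2.2.1) k π₁ π₂ π₃
  have e2 := abs_wZ3_le (fun w π => (hb w π).1) (fun w π => (hb w π).2.2.1)
    (fun w π => (hb w π).2.2.2.2.2.1) k π₁ π₂ π₃
  have e3 := abs_wZ3_le (fun w π => (hb w π).1) (fun w π => (hb w π).2.1)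
    (fun w π => (hb w π).2.2.2.2.2.2.1) k π₁ π₂ π₃
  have e4 := abs_wZ3_le (fun w π => (hb w π).2.2.2.1) (fun w π => (hb w π).2.1)
    (fun w π => (hb w π).2.2.2.2.2.2.2.1) k π₁ π₂ π₃
  have e5 := abs_wZ3_le (fun w π => (hb w π).2.2.2.1) (fun w π => (hb w π).2.2.1)
    (fun w π => (hb w π).2.2.2.2.2.2.2.2.1) k π₁ π₂ π₃
  have e6 := abs_wZ3_le (fun w π => (hb w π).2.2.2.1) (fun w π => (hb w π).2.1)
    (fun w π => (hb w π).2.2.2.2.2.2.2.2.2.1) k π₁ π₂ π₃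
  have e7 := abs_wZ3_le (fun w π => (hb w π).1) (fun w π => (hb w π).2.2.1)
    (fun w π => (hb w π).2.2.2.2.2.2.2.2.2.2.1) k π₁ π₂ π₃
  have e8 := abs_wZ3_le (fun w π => (hb w π).1) (fun w π => (hb w π).2.1)
    (fun w π => (hb w π).2.2.2.2.2.2.2.2.2.2.2) k π₁ π₂ π₃
  unfold Wtot3
  simp only [Pi.add_apply, Pi.sub_apply]
  rw [abs_le] at e1 e2 e3 e4 e5 e6 e7 e8 ⊢
  constructor <;> linarith

end Bounds

end Summit.Ventures.PercRepro2.Hub3
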